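import Mathlib
import HarnessLib

/-!
# The lattice Sobolev inequality in mixed-derivative form:
# `|f(x)|² ≤ (2/R)^d Σ_{y ∈ B} Σ_{α ∈ {0,1}^d} R^{2|α|} |∇^α f(y)|²` on a box `B` of side `R`

(namespace `Literature.Analysis.FunctionSpaces.LatticeSobolev`)

For a function `f` on the lattice `ℕ^d` (values in `ℝ`), a box `B = [0,R)^d` and a point `x ∈ B`,
the value `f(x)²` is controlled by the `ℓ²(B)`-norms of the MIXED forward differences
`∇^α f = Π_{i : α i = 1} ∇_i f`, `α ∈ {0,1}^d`, weighted by `R^{2|α|}`: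

  `f(x)² ≤ (2/R)^d · Σ_{y ∈ B} Σ_{α ∈ {0,1}^d} R^{2|α|} (∇^α f(y))²`   (`sq_le_sum_sq_mixedDiff`).

This is the *lattice Sobolev inequality* of Brydges–Slade [BrydgesSlade2015I, Lemma 6.6]
(«Let `f : B → ℂ`, where `B ∈ 𝓑` is a block of side length `R`. Let `∇_R = R∇`. Then for any
`x ∈ B`, `|f(x)|² ≤ 2^{3d+2} R^{−d} Σ_{y ∈ B} Σ_{|α|_∞ ≤ 1} |∇_R^α f(y)|²`»), here with the constant
`2^d` in place of `2^{3d+2}`; it is the form of the discrete Sobolev inequality («with `d`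
derivatives») that Adams–Buchholz–Kotecký–Müller [AdamsBuchholzKoteckyMuller2019, Lemma 7.9 and its
proof] cite from [BS15I] for the large-field regulators of the renormalisation group (property (w9)
of their Theorem 7.1, via Lemma 7.8): only mixed first-order differences, `|α|₁ ≤ d`, appear.

PROOF.  Not the printed corner-telescoping/reflection argument of [BS15I] but a shorter road with a
better constant: the one-dimensional estimate
`h(n₀)² ≤ (2/R) Σ_{n<R} (h(n)² + R² (h(n+1) − h(n))²)` (`sq_le_one_dim`: average
`|h(n₀)| ≤ |h(n)| + Σ_k |h(k+1) − h(k)|` over `n < R`, then Cauchy–Schwarz), followed by induction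
on the dimension `d` (slice along the first coordinate; the mixed differences of the slices
`t ↦ f(t, ·)` and `f(t+1, ·) − f(t, ·)` are exactly the mixed differences of `f` with `α₀ = 0`,
resp. `α₀ = 1`).  As in the printed statement, the differences at points `y` on the upper faces of
`B` look one step outside `B`; `f` is a function on all of `ℕ^d`.  Consumers on a torus or on `ℤ^d`
precompose `f` with an additive chart `n ↦ x₀ + n` (forward differences commute with it).

Everything below is proved; no named fact.

## References
* D. C. Brydges, G. Slade, *A renormalisation group method. I. Gaussian integration and normed
  algebras*, J. Stat. Phys. 159 (2015) 421–460, arXiv:1403.7244 — Lemma 6.6 (held text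
  `paper:arxiv-1403.7244`, «Lemma 6.3.2 (Lattice Sobolev inequality)»). [BrydgesSlade2015I]
* S. Adams, S. Buchholz, R. Kotecký, S. Müller, *Cauchy–Born rule from microscopic models with
  non-convex potentials*, arXiv:1910.13564 — Lemma 7.8, Lemma 7.9. [AdamsBuchholzKoteckyMuller2019]
-/

noncomputable section

namespace Literature.Analysis.FunctionSpaces.LatticeSobolev

open Finset

/-- The discrete box `[0,R)^d ⊂ ℕ^d` as a `Finset`. [folklore] -/
def box (d R : ℕ) : Finset (Fin d → ℕ) := Fintype.piFinset fun _ => Finset.range R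

/-- The mixed forward difference `∇^α f`, `α ∈ {0,1}^d` (`α i = true` ↔ differentiate once in
direction `i`), defined by recursion on the dimension: slice along coordinate `0`, take the
forward difference of the slices if `α 0 = true`, and recurse on the remaining coordinates.
(The `∇_i` commute, so this is `Π_{i : α i} ∇_i f`; see `mixedDiff_cons_true`,
`mixedDiff_cons_false`, `mixedDiff_zero`.) [cite: BrydgesSlade2015I, Lemma 6.6] -/
def mixedDiff : (d : ℕ) → (Fin d → Bool) → ((Fin d → ℕ) → ℝ) → (Fin d → ℕ) → ℝ
  | 0, _, f, x => f x
  | d + 1, α, f, x =>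
      if α 0 = true then
        mixedDiff d (Fin.tail α)
          (fun y => f (Fin.cons (x 0 + 1) y) - f (Fin.cons (x 0) y)) (Fin.tail x)
      else mixedDiff d (Fin.tail α) (fun y => f (Fin.cons (x 0) y)) (Fin.tail x)

/-- The order `|α| = #{i : α i = 1}` of a mixed difference. [folklore] -/
def weight {d : ℕ} (α : Fin d → Bool) : ℕ := ∑ i, (α i).toNat

/-! ## Structural lemmas -/

/-- In dimension `0` there is nothing to differentiate. [cite: BrydgesSlade2015I, Lemma 6.6] -/
theorem mixedDiff_zero (α : Fin 0 → Bool) (f : (Fin 0 → ℕ) → ℝ) (x : Fin 0 → ℕ) :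
    mixedDiff 0 α f x = f x := rfl

/-- Slicing with `α₀ = 1`: `∇^{(1,α')} f (t, y') = ∇^{α'} (f(t+1, ·) − f(t, ·)) (y')`.
[cite: BrydgesSlade2015I, Lemma 6.6] -/
theorem mixedDiff_cons_true {d : ℕ} (α' : Fin d → Bool) (f : (Fin (d + 1) → ℕ) → ℝ)
    (t : ℕ) (y' : Fin d → ℕ) :
    mixedDiff (d + 1) (Fin.cons true α') f (Fin.cons t y') =
      mixedDiff d α' (fun y => f (Fin.cons (t + 1) y) - f (Fin.cons t y)) y' := by
  simp only [mixedDiff, Fin.cons_zero, Fin.tail_cons, if_true]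

/-- Slicing with `α₀ = 0`: `∇^{(0,α')} f (t, y') = ∇^{α'} (f(t, ·)) (y')`.
[cite: BrydgesSlade2015I, Lemma 6.6] -/
theorem mixedDiff_cons_false {d : ℕ} (α' : Fin d → Bool) (f : (Fin (d + 1) → ℕ) → ℝ)
    (t : ℕ) (y' : Fin d → ℕ) :
    mixedDiff (d + 1) (Fin.cons false α') f (Fin.cons t y') =
      mixedDiff d α' (fun y => f (Fin.cons t y)) y' := by
  simp only [mixedDiff, Fin.cons_zero, Fin.tail_cons, Bool.false_eq_true, if_false]

/-- `|(b, α')| = b + |α'|`. [cite: BrydgesSlade2015I, Lemma 6.6] -/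
theorem weight_cons {d : ℕ} (b : Bool) (α' : Fin d → Bool) :
    weight (Fin.cons b α' : Fin (d + 1) → Bool) = b.toNat + weight α' := by
  simp only [weight, Fin.sum_univ_succ, Fin.cons_zero, Fin.cons_succ]

/-- Membership in the box `[0,R)^d`. [cite: BrydgesSlade2015I, Lemma 6.6] -/
theorem mem_box_iff {d R : ℕ} (x : Fin d → ℕ) : x ∈ box d R ↔ ∀ i, x i < R := by
  simp only [box, Fintype.mem_piFinset, Finset.mem_range]

/-- Membership in the box, sliced along the first coordinate.
[cite: BrydgesSlade2015I, Lemma 6.6] -/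
theorem cons_mem_box_iff {d R : ℕ} (t : ℕ) (y : Fin d → ℕ) :
    (Fin.cons t y : Fin (d + 1) → ℕ) ∈ box (d + 1) R ↔ t < R ∧ y ∈ box d R := by
  simp only [mem_box_iff, Fin.forall_fin_succ, Fin.cons_zero, Fin.cons_succ]

/-- Fubini for the box: sum over the first coordinate, then over the remaining ones. [folklore] -/
private theorem sum_box_succ {d R : ℕ} (G : (Fin (d + 1) → ℕ) → ℝ) :
    ∑ y ∈ box (d + 1) R, G y = ∑ t ∈ Finset.range R, ∑ y' ∈ box d R, G (Fin.cons t y') := by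
  have h := Finset.filter_piFinset_eq_map_consEquiv (fun _ : Fin (d + 1) => Finset.range R)
    (fun _ => True)
  simp only [Finset.filter_true] at h
  unfold box
  rw [h, Finset.sum_map, Finset.sum_product]
  rfl

/-- Splitting the sum over `α ∈ {0,1}^{d+1}` by the value of `α 0`. [folklore] -/
private theorem sum_bool_succ {d : ℕ} (H : (Fin (d + 1) → Bool) → ℝ) :
    ∑ α : Fin (d + 1) → Bool, H α =
      ∑ α' : Fin d → Bool, (H (Fin.cons true α') + H (Fin.cons false α')) := by
  rw [← (Fin.consEquiv fun _ : Fin (d + 1) => Bool).sum_comp, Fintype.sum_prod_type,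
    Fintype.sum_bool]
  rw [← Finset.sum_add_distrib]
  rfl

/-! ## `mixedDiff` is the composition of Mathlib's forward differences `fwdDiff (Pi.single i 1)`

The recursion defining `mixedDiff` fixes an order of the coordinates; the following lemmas show that
any coordinate can be peeled off first, so that `mixedDiff d α f = (Π_{i : α i} Δ_i) f` with
`Δ_i = fwdDiff (Pi.single i 1)` in any order. -/

/-- `(t, y) + e_0 = (t+1, y)` on `ℕ^{d+1}`. [folklore] -/
private theorem cons_add_single_zero {d : ℕ} (t : ℕ) (y : Fin d → ℕ) :
    (Fin.cons t y : Fin (d + 1) → ℕ) + Pi.single (0 : Fin (d + 1)) 1 = Fin.cons (t + 1) y := by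
  ext k
  refine Fin.cases ?_ (fun j => ?_) k
  · simp
  · simp [Fin.succ_ne_zero]

/-- `(t, y) + e_{j+1} = (t, y + e_j)` on `ℕ^{d+1}`. [folklore] -/
private theorem cons_add_single_succ {d : ℕ} (t : ℕ) (y : Fin d → ℕ) (j : Fin d) :
    (Fin.cons t y : Fin (d + 1) → ℕ) + Pi.single j.succ 1 = Fin.cons t (y + Pi.single j 1) := by
  ext k
  refine Fin.cases ?_ (fun i => ?_) k
  · simp [(Fin.succ_ne_zero j).symm]
  · by_cases hij : i = j
    · subst hij; simp
    · simp [hij, (Fin.succ_injective d).ne hij]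

/-- Slices of a forward difference in direction `0`. [folklore] -/
private theorem fwdDiff_single_zero_cons {d : ℕ} (f : (Fin (d + 1) → ℕ) → ℝ) (t : ℕ)
    (y : Fin d → ℕ) :
    fwdDiff (Pi.single (0 : Fin (d + 1)) 1) f (Fin.cons t y) =
      f (Fin.cons (t + 1) y) - f (Fin.cons t y) := by
  simp only [fwdDiff, cons_add_single_zero]

/-- Slices of a forward difference in a direction `j.succ` are forward differences of the slices.
[folklore] -/
private theorem fwdDiff_single_succ_cons {d : ℕ} (f : (Fin (d + 1) → ℕ) → ℝ) (t : ℕ) (j : Fin d)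
    (y : Fin d → ℕ) :
    fwdDiff (Pi.single j.succ 1) f (Fin.cons t y) =
      fwdDiff (Pi.single j 1) (fun y' => f (Fin.cons t y')) y := by
  simp only [fwdDiff, cons_add_single_succ]

/-- No derivative: `∇^0 f = f`. [cite: BrydgesSlade2015I, Lemma 6.6] -/
theorem mixedDiff_false (d : ℕ) (f : (Fin d → ℕ) → ℝ) (x : Fin d → ℕ) :
    mixedDiff d (fun _ => false) f x = f x := by
  induction d with
  | zero => rfl
  | succ d ih =>
    have hα : (fun _ : Fin (d + 1) => false) = Fin.cons false (fun _ : Fin d => false) := by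
      ext k; refine Fin.cases ?_ (fun j => ?_) k <;> simp
    conv_lhs => rw [hα, ← Fin.cons_self_tail x, mixedDiff_cons_false]
    rw [ih, Fin.cons_self_tail]

/-- **Peeling a coordinate**: if `α i = 0`, then `∇^{α + e_i} f = ∇^α (Δ_i f)` with
`Δ_i = fwdDiff (Pi.single i 1)` Mathlib's forward difference — in particular the mixed difference
does not depend on the order in which the coordinates are differentiated.
[cite: BrydgesSlade2015I, Lemma 6.6] -/
theorem mixedDiff_update_true {d : ℕ} (α : Fin d → Bool) (i : Fin d) (hi : α i = false)
    (f : (Fin d → ℕ) → ℝ) (x : Fin d → ℕ) :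
    mixedDiff d (Function.update α i true) f x =
      mixedDiff d α (fwdDiff (Pi.single i 1) f) x := by
  induction d with
  | zero => exact i.elim0
  | succ d ih =>
    -- split `x = (t, y)` and `α = (α 0, α')`
    obtain ⟨t, y, rfl⟩ : ∃ t y, x = Fin.cons t y := ⟨x 0, Fin.tail x, (Fin.cons_self_tail x).symm⟩
    set α' : Fin d → Bool := Fin.tail α with hα'
    have hαsplit : α = Fin.cons (α 0) α' := (Fin.cons_self_tail α).symm
    refine Fin.cases ?_ (fun j => ?_) i hi
    · -- i = 0
      intro h0
      have hupd : Function.update α 0 true = Fin.cons true α' := by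
        rw [hαsplit, Fin.update_cons_zero]
      rw [hupd, mixedDiff_cons_true]
      conv_rhs => rw [hαsplit, h0, mixedDiff_cons_false]
      simp only [fwdDiff_single_zero_cons]
    · -- i = j.succ
      intro hj
      have hj' : α' j = false := by rw [hα']; exact hj
      have hupd : Function.update α j.succ true = Fin.cons (α 0) (Function.update α' j true) := by
        conv_lhs => rw [hαsplit]
        rw [Fin.cons_update]
      rw [hupd]
      cases h0 : α 0
      · -- α 0 = false
        rw [mixedDiff_cons_false, ih α' j hj']
        conv_rhs => rw [hαsplit, h0, mixedDiff_cons_false]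
        simp only [fwdDiff_single_succ_cons]
      · -- α 0 = true
        rw [mixedDiff_cons_true, ih α' j hj']
        conv_rhs => rw [hαsplit, h0, mixedDiff_cons_true]
        congr 1
        funext y'
        simp only [fwdDiff, cons_add_single_succ]
        ring

/-- A single derivative: `∇^{e_i} f = Δ_i f = f(· + e_i) − f`.
[cite: BrydgesSlade2015I, Lemma 6.6] -/
theorem mixedDiff_single {d : ℕ} (i : Fin d) (f : (Fin d → ℕ) → ℝ) (x : Fin d → ℕ) :
    mixedDiff d (Function.update (fun _ => false) i true) f x = f (x + Pi.single i 1) - f x := by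
  rw [mixedDiff_update_true _ i rfl, mixedDiff_false]
  rfl

/-! ## The one-dimensional estimate -/

/-- Telescoping bound: `|h(n₀) − h(n)| ≤ Σ_{k<R} |h(k+1) − h(k)|` for `n, n₀ < R`. [folklore] -/
private theorem abs_sub_le_sum_abs_diff (h : ℕ → ℝ) {R n n₀ : ℕ} (hn : n < R) (hn₀ : n₀ < R) :
    |h n₀ - h n| ≤ ∑ k ∈ Finset.range R, |h (k + 1) - h k| := by
  -- telescoping over `Ico (min n n₀) (max n n₀)`
  have tele : ∀ {m p : ℕ}, m ≤ p → p < R →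
      |h p - h m| ≤ ∑ k ∈ Finset.range R, |h (k + 1) - h k| := by
    intro m p hmp hpR
    have hsum : ∑ k ∈ Finset.Ico m p, (h (k + 1) - h k) = h p - h m := by
      rw [Finset.sum_Ico_eq_sum_range]
      have := Finset.sum_range_sub (fun k => h (m + k)) (p - m)
      simp only [Nat.add_sub_cancel' hmp, add_zero] at this
      rw [← this]
      exact Finset.sum_congr rfl fun k _ => by rw [add_assoc]
    rw [← hsum]
    refine (Finset.abs_sum_le_sum_abs _ _).trans ?_
    refine Finset.sum_le_sum_of_subset_of_nonneg ?_ fun k _ _ => abs_nonneg _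
    intro k hk
    rw [Finset.mem_Ico] at hk
    exact Finset.mem_range.mpr (lt_of_lt_of_le hk.2 hpR.le)
  rcases le_total n n₀ with hle | hle
  · exact tele hle hn₀
  · rw [abs_sub_comm]; exact tele hle hn

/-- **One-dimensional lattice Sobolev inequality**:
`h(n₀)² ≤ (2/R) Σ_{n<R} (h(n)² + R² (h(n+1) − h(n))²)` for `n₀ < R`.
[cite: BrydgesSlade2015I, Lemma 6.6] -/
theorem sq_le_one_dim {R : ℕ} (h : ℕ → ℝ) {n₀ : ℕ} (hn₀ : n₀ < R) :
    h n₀ ^ 2 ≤ 2 / R * ∑ n ∈ Finset.range R, (h n ^ 2 + (R : ℝ) ^ 2 * (h (n + 1) - h n) ^ 2) := by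
  have hR : 0 < R := lt_of_le_of_lt (Nat.zero_le _) hn₀
  have hRpos : (0 : ℝ) < R := by exact_mod_cast hR
  set A : ℝ := ∑ n ∈ Finset.range R, |h n| with hA
  set D : ℝ := ∑ k ∈ Finset.range R, |h (k + 1) - h k| with hD
  -- pointwise: |h n₀| ≤ |h n| + D
  have key : ∀ n ∈ Finset.range R, |h n₀| ≤ |h n| + D := by
    intro n hn
    have hn' := Finset.mem_range.mp hn
    have hsub := abs_sub_le_sum_abs_diff h hn' hn₀
    calc |h n₀| = |h n + (h n₀ - h n)| := by ring_nf
      _ ≤ |h n| + |h n₀ - h n| := abs_add_le _ _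
      _ ≤ |h n| + D := by linarith
  -- average over n
  have havg : (R : ℝ) * |h n₀| ≤ A + R * D := by
    have := Finset.sum_le_sum key
    simp only [Finset.sum_const, Finset.card_range, nsmul_eq_mul, Finset.sum_add_distrib] at this
    linarith
  -- Cauchy–Schwarz
  have hA2 : A ^ 2 ≤ R * ∑ n ∈ Finset.range R, h n ^ 2 := by
    have := sq_sum_le_card_mul_sum_sq (s := Finset.range R) (f := fun n => |h n|)
    simp only [Finset.card_range, sq_abs] at this
    exact this
  have hD2 : D ^ 2 ≤ R * ∑ k ∈ Finset.range R, (h (k + 1) - h k) ^ 2 := by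
    have := sq_sum_le_card_mul_sum_sq (s := Finset.range R)
      (f := fun k => |h (k + 1) - h k|)
    simp only [Finset.card_range, sq_abs] at this
    exact this
  have hA0 : 0 ≤ A := Finset.sum_nonneg fun _ _ => abs_nonneg _
  have hD0 : 0 ≤ D := Finset.sum_nonneg fun _ _ => abs_nonneg _
  have hS0 : 0 ≤ ∑ n ∈ Finset.range R, h n ^ 2 := Finset.sum_nonneg fun _ _ => sq_nonneg _
  have hT0 : 0 ≤ ∑ k ∈ Finset.range R, (h (k + 1) - h k) ^ 2 :=
    Finset.sum_nonneg fun _ _ => sq_nonneg _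
  -- |h n₀| ≤ A/R + D
  have h1 : |h n₀| ≤ A / R + D := by
    rw [div_add' _ _ _ hRpos.ne', le_div_iff₀ hRpos]
    linarith
  have h2 : h n₀ ^ 2 ≤ 2 * (A / R) ^ 2 + 2 * D ^ 2 := by
    have h0 : 0 ≤ |h n₀| := abs_nonneg _
    have : |h n₀| ^ 2 ≤ (A / R + D) ^ 2 := pow_le_pow_left₀ h0 h1 2
    rw [sq_abs] at this
    nlinarith [sq_nonneg (A / R - D)]
  calc h n₀ ^ 2 ≤ 2 * (A / R) ^ 2 + 2 * D ^ 2 := h2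
    _ ≤ 2 * ((R * ∑ n ∈ Finset.range R, h n ^ 2) / R ^ 2) +
        2 * (R * ∑ k ∈ Finset.range R, (h (k + 1) - h k) ^ 2) := by
        rw [div_pow]
        gcongr
    _ = 2 / R * ∑ n ∈ Finset.range R, (h n ^ 2 + (R : ℝ) ^ 2 * (h (n + 1) - h n) ^ 2) := by
        rw [Finset.sum_add_distrib, ← Finset.mul_sum]
        field_simp

/-! ## The `d`-dimensional inequality -/

/-- **Lattice Sobolev inequality (mixed-derivative form)**: for `f : ℕ^d → ℝ`, a box
`B = [0,R)^d` and `x ∈ B`,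
`f(x)² ≤ (2/R)^d Σ_{y ∈ B} Σ_{α ∈ {0,1}^d} R^{2|α|} (∇^α f(y))²`.
([BS15I] prints the constant `2^{3d+2}`; see the module docstring for the proof used here.)
[cite: BrydgesSlade2015I, Lemma 6.6] -/
theorem sq_le_sum_sq_mixedDiff (d R : ℕ) (f : (Fin d → ℕ) → ℝ) (x : Fin d → ℕ)
    (hx : x ∈ box d R) :
    f x ^ 2 ≤ (2 / R) ^ d *
      ∑ y ∈ box d R, ∑ α : Fin d → Bool, (R : ℝ) ^ (2 * weight α) * mixedDiff d α f y ^ 2 := by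
  induction d with
  | zero =>
    -- the box is the single point `x`; keep only the term `y = x`
    rw [pow_zero, one_mul]
    have hterm : ∀ y : Fin 0 → ℕ,
        ∑ α : Fin 0 → Bool, (R : ℝ) ^ (2 * weight α) * mixedDiff 0 α f y ^ 2 = f y ^ 2 := by
      intro y
      rw [Fintype.sum_unique]
      simp [weight, mixedDiff]
    have hxy : ∀ y : Fin 0 → ℕ, y = x := fun y => Subsingleton.elim y x
    calc f x ^ 2 = ∑ α : Fin 0 → Bool, (R : ℝ) ^ (2 * weight α) * mixedDiff 0 α f x ^ 2 :=
          (hterm x).symm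
      _ ≤ ∑ y ∈ box 0 R, ∑ α : Fin 0 → Bool, (R : ℝ) ^ (2 * weight α) * mixedDiff 0 α f y ^ 2 :=
          Finset.single_le_sum (f := fun y => ∑ α : Fin 0 → Bool,
              (R : ℝ) ^ (2 * weight α) * mixedDiff 0 α f y ^ 2)
            (fun y _ => by rw [hterm]; exact sq_nonneg _) hx
  | succ d ih =>
    -- split `x = (x₀, x')`
    set x₀ : ℕ := x 0 with hx₀
    set x' : Fin d → ℕ := Fin.tail x with hx'
    have hxsplit : x = Fin.cons x₀ x' := (Fin.cons_self_tail x).symm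
    rw [hxsplit, cons_mem_box_iff] at hx
    obtain ⟨hx₀R, hx'B⟩ := hx
    have hRpos : (0 : ℝ) < R := by exact_mod_cast lt_of_le_of_lt (Nat.zero_le _) hx₀R
    -- the slices
    set g : ℕ → (Fin d → ℕ) → ℝ := fun t y => f (Fin.cons t y) with hg
    have hfx : f x = g x₀ x' := by rw [hxsplit]
    -- one-dimensional estimate along coordinate 0
    have h1 := sq_le_one_dim (fun t => g t x') hx₀R
    -- induction hypothesis on each slice and each slice difference
    have hA : ∀ t, g t x' ^ 2 ≤ (2 / R) ^ d * ∑ y' ∈ box d R, ∑ α' : Fin d → Bool,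
        (R : ℝ) ^ (2 * weight α') *
          mixedDiff (d + 1) (Fin.cons false α') f (Fin.cons t y') ^ 2 := by
      intro t
      have := ih (g t) x' hx'B
      simp only [mixedDiff_cons_false]
      exact this
    have hB : ∀ t, (g (t + 1) x' - g t x') ^ 2 ≤ (2 / R) ^ d * ∑ y' ∈ box d R,
        ∑ α' : Fin d → Bool, (R : ℝ) ^ (2 * weight α') *
          mixedDiff (d + 1) (Fin.cons true α') f (Fin.cons t y') ^ 2 := by
      intro t
      have := ih (fun y => g (t + 1) y - g t y) x' hx'B
      simp only [mixedDiff_cons_true]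
      exact this
    -- rewrite the target sum by slicing `y = (t, y')` and `α = (b, α')`
    have htarget : ∑ y ∈ box (d + 1) R, ∑ α : Fin (d + 1) → Bool,
        (R : ℝ) ^ (2 * weight α) * mixedDiff (d + 1) α f y ^ 2 =
        ∑ t ∈ Finset.range R, ∑ y' ∈ box d R, ∑ α' : Fin d → Bool,
          ((R : ℝ) ^ 2 * ((R : ℝ) ^ (2 * weight α') *
              mixedDiff (d + 1) (Fin.cons true α') f (Fin.cons t y') ^ 2) +
            (R : ℝ) ^ (2 * weight α') *
              mixedDiff (d + 1) (Fin.cons false α') f (Fin.cons t y') ^ 2) := by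
      rw [sum_box_succ]
      refine Finset.sum_congr rfl fun t _ => Finset.sum_congr rfl fun y' _ => ?_
      rw [sum_bool_succ]
      refine Finset.sum_congr rfl fun α' _ => ?_
      simp only [weight_cons, Bool.toNat_true, Bool.toNat_false, zero_add]
      ring
    rw [htarget, hfx]
    -- assemble
    calc g x₀ x' ^ 2
        ≤ 2 / R * ∑ t ∈ Finset.range R,
            (g t x' ^ 2 + (R : ℝ) ^ 2 * (g (t + 1) x' - g t x') ^ 2) := h1
      _ ≤ 2 / R * ∑ t ∈ Finset.range R,
            ((2 / R) ^ d * ∑ y' ∈ box d R, ∑ α' : Fin d → Bool,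
                (R : ℝ) ^ (2 * weight α') *
                  mixedDiff (d + 1) (Fin.cons false α') f (Fin.cons t y') ^ 2 +
              (R : ℝ) ^ 2 * ((2 / R) ^ d * ∑ y' ∈ box d R, ∑ α' : Fin d → Bool,
                (R : ℝ) ^ (2 * weight α') *
                  mixedDiff (d + 1) (Fin.cons true α') f (Fin.cons t y') ^ 2)) := by
          gcongr with t ht
          · exact hA t
          · exact hB t
      _ = ∑ t ∈ Finset.range R, 2 / R * ((2 / R) ^ d * ∑ y' ∈ box d R, ∑ α' : Fin d → Bool,
            ((R : ℝ) ^ 2 * ((R : ℝ) ^ (2 * weight α') *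
                mixedDiff (d + 1) (Fin.cons true α') f (Fin.cons t y') ^ 2) +
              (R : ℝ) ^ (2 * weight α') *
                mixedDiff (d + 1) (Fin.cons false α') f (Fin.cons t y') ^ 2)) := by
          rw [Finset.mul_sum]
          refine Finset.sum_congr rfl fun t _ => ?_
          congr 1
          simp only [Finset.sum_add_distrib, ← Finset.mul_sum]
          ring
      _ = (2 / R) ^ (d + 1) * ∑ t ∈ Finset.range R, ∑ y' ∈ box d R, ∑ α' : Fin d → Bool,
            ((R : ℝ) ^ 2 * ((R : ℝ) ^ (2 * weight α') *
                mixedDiff (d + 1) (Fin.cons true α') f (Fin.cons t y') ^ 2) +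
              (R : ℝ) ^ (2 * weight α') *
                mixedDiff (d + 1) (Fin.cons false α') f (Fin.cons t y') ^ 2) := by
          rw [Finset.mul_sum]
          exact Finset.sum_congr rfl fun t _ => by ring

/-- The inequality in sup form over the box. [cite: BrydgesSlade2015I, Lemma 6.6] -/
theorem forall_sq_le_sum_sq_mixedDiff (d R : ℕ) (f : (Fin d → ℕ) → ℝ) :
    ∀ x ∈ box d R, f x ^ 2 ≤ (2 / R) ^ d *
      ∑ y ∈ box d R, ∑ α : Fin d → Bool, (R : ℝ) ^ (2 * weight α) * mixedDiff d α f y ^ 2 :=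
  fun x hx => sq_le_sum_sq_mixedDiff d R f x hx

/-! ## Transfer to an additive chart (torus `(ℤ/M)^d`, `ℤ^d`, …)

A consumer whose field lives on an additive monoid `M` (e.g. the discrete torus `Fin d → ZMod M'`
or `Fin d → ℤ`) charts a box by an additive map `φ : (Fin d → ℕ) →+ M` and a base point `m₀`:
`n ↦ m₀ + φ n`.  The mixed differences of `F ∘ (m₀ + φ ·)` on `ℕ^d` are the mixed forward
differences of `F` on `M` along the step vectors `φ(e_i)` (`mixedDiff_comp_chart`), so the
inequality transfers verbatim (`sq_le_sum_sq_mixedFwdDiff_chart`). -/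

section Chart

variable {M : Type*} [AddCommMonoid M]

/-- Mixed forward differences on an additive monoid along step vectors `v i`:
`(Π_{i : α i} Δ_{v i}) F` with `Δ_v F (m) = F(m + v) − F(m)` Mathlib's `fwdDiff`; recursion on
`d` peeling coordinate `0` first (the `Δ_v` commute). [cite: BrydgesSlade2015I, Lemma 6.6] -/
def mixedFwdDiff : (d : ℕ) → (Fin d → M) → (Fin d → Bool) → (M → ℝ) → M → ℝ
  | 0, _, _, F => F
  | d + 1, v, α, F =>
      if α 0 = true then mixedFwdDiff d (Fin.tail v) (Fin.tail α) (fwdDiff (v 0) F)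
      else mixedFwdDiff d (Fin.tail v) (Fin.tail α) F

/-- Peeling coordinate `0`, `α₀ = 1`. [cite: BrydgesSlade2015I, Lemma 6.6] -/
theorem mixedFwdDiff_cons_true {d : ℕ} (v₀ : M) (v : Fin d → M) (α : Fin d → Bool) (F : M → ℝ) :
    mixedFwdDiff (d + 1) (Fin.cons v₀ v) (Fin.cons true α) F =
      mixedFwdDiff d v α (fwdDiff v₀ F) := by
  simp only [mixedFwdDiff, Fin.cons_zero, Fin.tail_cons, if_true]

/-- Peeling coordinate `0`, `α₀ = 0`. [cite: BrydgesSlade2015I, Lemma 6.6] -/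
theorem mixedFwdDiff_cons_false {d : ℕ} (v₀ : M) (v : Fin d → M) (α : Fin d → Bool)
    (F : M → ℝ) :
    mixedFwdDiff (d + 1) (Fin.cons v₀ v) (Fin.cons false α) F = mixedFwdDiff d v α F := by
  simp only [mixedFwdDiff, Fin.cons_zero, Fin.tail_cons, Bool.false_eq_true, if_false]

/-- `(t, y) = (t, 0) + (0, y)` on `ℕ^{d+1}`. [folklore] -/
private theorem cons_eq_cons_zero_add {d : ℕ} (t : ℕ) (y : Fin d → ℕ) :
    (Fin.cons t y : Fin (d + 1) → ℕ) = Fin.cons t (0 : Fin d → ℕ) + Fin.cons 0 y := by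
  ext k
  refine Fin.cases ?_ (fun j => ?_) k <;> simp

/-- `(0, y) + (0, y') = (0, y + y')` on `ℕ^{d+1}`. [folklore] -/
private theorem cons_zero_add_cons_zero {d : ℕ} (y y' : Fin d → ℕ) :
    (Fin.cons 0 y : Fin (d + 1) → ℕ) + Fin.cons 0 y' = Fin.cons 0 (y + y') := by
  ext k
  refine Fin.cases ?_ (fun j => ?_) k <;> simp

/-- The restriction of an additive chart of `ℕ^{d+1}` to the last `d` coordinates. [folklore] -/
private def tailHom {d : ℕ} (φ : (Fin (d + 1) → ℕ) →+ M) : (Fin d → ℕ) →+ M where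
  toFun y := φ (Fin.cons 0 y)
  map_zero' := by
    have : (Fin.cons (0 : ℕ) (0 : Fin d → ℕ) : Fin (d + 1) → ℕ) = 0 := by
      ext k; refine Fin.cases ?_ (fun j => ?_) k <;> simp
    rw [this, map_zero]
  map_add' y y' := by rw [← map_add, cons_zero_add_cons_zero]

/-- Unfolding `tailHom`. [folklore] -/
private theorem tailHom_apply {d : ℕ} (φ : (Fin (d + 1) → ℕ) →+ M) (y : Fin d → ℕ) :
    tailHom φ y = φ (Fin.cons 0 y) := rfl

/-- `(0, e_j) = e_{j+1}` on `ℕ^{d+1}`. [folklore] -/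
private theorem cons_zero_single {d : ℕ} (j : Fin d) :
    (Fin.cons 0 (Pi.single j 1) : Fin (d + 1) → ℕ) = Pi.single j.succ 1 := by
  have h := cons_add_single_succ (d := d) 0 0 j
  have h0 : (Fin.cons (0 : ℕ) (0 : Fin d → ℕ) : Fin (d + 1) → ℕ) = 0 := by
    ext k; refine Fin.cases ?_ (fun i => ?_) k <;> simp
  rw [h0, zero_add, zero_add] at h
  exact h.symm

/-- The step vectors of the tail chart are `φ(e_{j+1})`. [folklore] -/
private theorem tailHom_single {d : ℕ} (φ : (Fin (d + 1) → ℕ) →+ M) (j : Fin d) :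
    tailHom φ (Pi.single j 1) = φ (Pi.single j.succ 1) := by
  rw [tailHom_apply, cons_zero_single]

/-- `φ(t, y) = φ(t, 0) + φ(0, y)`. [folklore] -/
private theorem chart_cons {d : ℕ} (φ : (Fin (d + 1) → ℕ) →+ M) (t : ℕ) (y : Fin d → ℕ) :
    φ (Fin.cons t y) = φ (Fin.cons t (0 : Fin d → ℕ)) + tailHom φ y := by
  rw [tailHom_apply, ← map_add, ← cons_eq_cons_zero_add]

/-- `φ(t+1, y) = φ(t, y) + φ(e_0)`. [folklore] -/
private theorem chart_cons_succ {d : ℕ} (φ : (Fin (d + 1) → ℕ) →+ M) (t : ℕ) (y : Fin d → ℕ) :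
    φ (Fin.cons (t + 1) y) = φ (Fin.cons t y) + φ (Pi.single 0 1) := by
  rw [← map_add, cons_add_single_zero]

/-- **Transfer of the mixed differences along an additive chart**: for `φ : ℕ^d →+ M`, a base
point `m₀` and `F : M → ℝ`,
`∇^α (F ∘ (m₀ + φ ·)) (n) = (Π_{i : α i} Δ_{φ(e_i)}) F (m₀ + φ n)`.
[cite: BrydgesSlade2015I, Lemma 6.6] -/
theorem mixedDiff_comp_chart (d : ℕ) (φ : (Fin d → ℕ) →+ M) (m₀ : M) (F : M → ℝ)
    (α : Fin d → Bool) (n : Fin d → ℕ) :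
    mixedDiff d α (fun k => F (m₀ + φ k)) n =
      mixedFwdDiff d (fun i => φ (Pi.single i 1)) α F (m₀ + φ n) := by
  induction d generalizing m₀ F with
  | zero => rfl
  | succ d ih =>
    obtain ⟨t, y, rfl⟩ : ∃ t y, n = Fin.cons t y := ⟨n 0, Fin.tail n, (Fin.cons_self_tail n).symm⟩
    have hα : α = Fin.cons (α 0) (Fin.tail α) := (Fin.cons_self_tail α).symm
    have hv : (fun i : Fin (d + 1) => φ (Pi.single i 1)) =
        Fin.cons (φ (Pi.single 0 1)) (fun j : Fin d => tailHom φ (Pi.single j 1)) := by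
      ext k
      refine Fin.cases ?_ (fun j => ?_) k
      · simp
      · simp [tailHom_single]
    -- the slices of `F ∘ (m₀ + φ ·)` are charts of the tail with base point `m₀ + φ(t,0)`
    have hslice : ∀ s : ℕ, (fun y' : Fin d → ℕ => F (m₀ + φ (Fin.cons s y'))) =
        fun y' => F ((m₀ + φ (Fin.cons s (0 : Fin d → ℕ))) + tailHom φ y') := by
      intro s; funext y'; rw [chart_cons, add_assoc]
    rw [hv]
    cases h0 : α 0
    · -- α 0 = false
      rw [hα, h0, mixedDiff_cons_false, mixedFwdDiff_cons_false, hslice t, ih,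
        chart_cons φ t y, add_assoc]
    · -- α 0 = true
      rw [hα, h0, mixedDiff_cons_true, mixedFwdDiff_cons_true]
      have hdiff : (fun y' : Fin d → ℕ =>
          F (m₀ + φ (Fin.cons (t + 1) y')) - F (m₀ + φ (Fin.cons t y'))) =
          fun y' => (fwdDiff (φ (Pi.single 0 1)) F)
            ((m₀ + φ (Fin.cons t (0 : Fin d → ℕ))) + tailHom φ y') := by
        funext y'
        simp only [fwdDiff, chart_cons_succ φ t y', chart_cons φ t y', add_assoc]
      rw [hdiff, ih, chart_cons φ t y, add_assoc]

/-- **Lattice Sobolev inequality through an additive chart** (the form used on the discrete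
torus `Fin d → ZMod M'` with `φ n = (n i : ZMod M')_i`, or on `ℤ^d`): for `φ : ℕ^d →+ M`, a base
point `m₀`, `F : M → ℝ` and `n₀ ∈ [0,R)^d`,
`F(m₀ + φ n₀)² ≤ (2/R)^d Σ_{n ∈ [0,R)^d} Σ_{α} R^{2|α|} ((Π_{i:α i} Δ_{φ(e_i)}) F (m₀ + φ n))²`.
[cite: BrydgesSlade2015I, Lemma 6.6] -/
theorem sq_le_sum_sq_mixedFwdDiff_chart (d R : ℕ) (φ : (Fin d → ℕ) →+ M) (m₀ : M) (F : M → ℝ)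
    (n₀ : Fin d → ℕ) (hn₀ : n₀ ∈ box d R) :
    F (m₀ + φ n₀) ^ 2 ≤ (2 / R) ^ d * ∑ n ∈ box d R, ∑ α : Fin d → Bool,
      (R : ℝ) ^ (2 * weight α) *
        mixedFwdDiff d (fun i => φ (Pi.single i 1)) α F (m₀ + φ n) ^ 2 := by
  have h := sq_le_sum_sq_mixedDiff d R (fun k => F (m₀ + φ k)) n₀ hn₀
  simp only [mixedDiff_comp_chart] at h
  exact h

end Chart

end Literature.Analysis.FunctionSpaces.LatticeSobolev

end
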